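import Summits.Ventures.HSemireg.Pad4TowerDiamondMu4
import Summits.Ventures.HSemireg.Pad4TowerPsiSubA1

/-!
# StrengthenCleanModule — typed S⁺ family of MEMO-01 (plan-lens-HodgeAV-strengthen g0, lens «strengthen», BLOCK E3)

HONEST FRAMING. Typed `Prop`s (no proofs) stating the CLEAN-MODULE STRUCTURE THEOREMS of
`ideators/plan-lens-HodgeAV-strengthen/memo-01/MEMO-01-CLEAN-MODULE.md` over the tree's letter-model vocabulary of record
(`BPoint`, `MCell`, `ray`, `InDiamond`, `bphi`, `MCell.ch`, `ClassScreen`, `refWord`, `eWord`, `ebarWord`). They are proved by PENCIL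
(light-cone grid recursion, memo §2–§3) and checked by an exact engine for `h ≤ 16` and on four designs of record — NOT in the kernel.
Nothing here is a statement about a variety, a sheaf, a monad, `σ`, a seed or an abelian variety; NOTHING here bears on
18881 ∕ H2 ∕ HC_AV ∕ HC_CM ∕ HC. No `instance`, no notation, no `sorry`, no axiom beyond the standard ones.

* `nullSecondDiff x k`  — move R1: `δ_x − 2·δ_{x+n_k} + δ_{x+2n_k}` along the null ray of phase `k`;
* `phaseSquare a c`     — move R2: `δ_{(a,c)} + δ_{(a,−c)} − δ_{(a,ic)} − δ_{(a,−ic)}` (conv-A coordinates `(a, Re β, Im β)`);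
* `DiamondNullGenerated h`      — THEOREM A: inside `◇_h` the letter-null module is the ℤ-span of the R1∕R2 instances;
* `BaseSpan`, `BaseIndependent` — the five base letters `O, 2I, ℓ_{i^0}, ℓ_{i^2}, ℓ_{i^1}` carry the image lattice freely;
* `DiamondCellNullGenerated h`  — THEOREM N: a null DESIGN on `◇_h⁴` is a ℤ-combination of single-factor elementary pieces;
* `CleanRigidity h`             — THEOREM C (integral form): two (A1)-clean designs on `◇_h⁴` with the same eleven invariants
                                   `(λ₀,…,λ₈, μ, μ̄)` differ by elementary null pieces.
-/

namespace Summit.HodgeConjecture.HodgeConjecture.Cruxes.BlochSeedDiscOne.StrengthenCleanModule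

open Summit.Ventures.HSemireg.Pad4Tower

/-! ## §1 The two move types on letters -/

/-- move R1 (null-ray second difference): `δ_x − 2·δ_{x + n_k} + δ_{x + 2 n_k}`, `n_k = step k` the null step of phase `i^k`.
It is letter-null because every class coordinate `1, α, β, β̄, α² − |β|²` is AFFINE along a null ray (`|ζ| = 1`). -/
noncomputable def nullSecondDiff (x : BPoint) (k : Fin 4) : BPoint →₀ ℤ :=
  Finsupp.single x 1 - 2 • Finsupp.single (ray x k 1) 1 + Finsupp.single (ray x k 2) 1

/-- move R2 (phase square at `(a, c)`, `c ≥ 1`): `δ_{(a,c,0)} + δ_{(a,−c,0)} − δ_{(a,0,c)} − δ_{(a,0,−c)}`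
(the four letters share `1, α, α² − c²` and their signed `β`-, `β̄`-sums vanish). -/
noncomputable def phaseSquare (a c : ℤ) : BPoint →₀ ℤ :=
  Finsupp.single (a, c, 0) 1 + Finsupp.single (a, -c, 0) 1 - Finsupp.single (a, 0, c) 1 - Finsupp.single (a, 0, -c) 1

/-- the R1∕R2 instances lying inside `◇_h`. -/
def diamondMoves (h : ℤ) : Set (BPoint →₀ ℤ) :=
  {r | ∃ x : BPoint, ∃ k : Fin 4, InDiamond h x ∧ InDiamond h (ray x k 1) ∧ InDiamond h (ray x k 2) ∧ r = nullSecondDiff x k} ∪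
    {r | ∃ a c : ℤ, 1 ≤ c ∧ InDiamond h (a, c, 0) ∧ r = phaseSquare a c}

/-- a finitely supported integer letter-combination is LETTER-NULL: all six class coordinates of `Σ ν(x)·bphi x` vanish. -/
def LetterNull (ν : BPoint →₀ ℤ) : Prop :=
  ∀ l : Fin 6, (ν.sum fun x m => (m : GaussianInt) * bphi x l) = 0

/-- support inside the diamond `◇_h`. -/
def SupportedIn (h : ℤ) (ν : BPoint →₀ ℤ) : Prop := ∀ x ∈ ν.support, InDiamond h x

/-- **THEOREM A (typed)**: inside `◇_h` every letter-null combination is a ℤ-combination of R1∕R2 instances inside `◇_h`.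
(Pencil: light-cone grid recursion per real slice; exact check `h = 2, 4, …, 16`: rank(R1 ∪ R2) = |◇_h| − 5.) Intended for even `h ≥ 2`. -/
def DiamondNullGenerated (h : ℤ) : Prop :=
  ∀ ν : BPoint →₀ ℤ, SupportedIn h ν → LetterNull ν → ν ∈ Submodule.span ℤ (diamondMoves h)

/-- the five BASE letters `O, 2I, ℓ_{i^0} = (1,1,0), ℓ_{i^2} = (1,−1,0), ℓ_{i^1} = (1,0,−1)` (= `step 0, step 2, step 1` shifted from `O`). -/
def baseLetter : Fin 5 → BPoint := ![(0, 0, 0), (2, 0, 0), (1, 1, 0), (1, -1, 0), (1, 0, -1)]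

/-- **BASE SPAN (typed)**: the class vector of every diamond letter is an INTEGER combination of the five base letters' class vectors
(the reduction `κ` of memo §2 (ii); `max |κ| = (h∕2)²`). -/
def BaseSpan : Prop :=
  ∀ h : ℤ, ∀ x : BPoint, InDiamond h x →
    ∃ κ : Fin 5 → ℤ, ∀ l : Fin 6, bphi x l = ∑ j, (κ j : GaussianInt) * bphi (baseLetter j) l

/-- **BASE INDEPENDENCE (typed)**: the five base class vectors are `ℤ[i]`-linearly independent. -/
def BaseIndependent : Prop :=
  ∀ κ : Fin 5 → GaussianInt, (∀ l : Fin 6, ∑ j, κ j * bphi (baseLetter j) l = 0) → κ = 0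

/-! ## §2 Designs: elementary pieces, THEOREM N, THEOREM C (integral form) -/

/-- an ELEMENTARY PIECE: the letter combination `r` placed in factor `f` of the cell `Y` (other three letters fixed). -/
noncomputable def elemPiece (f : Fin 4) (r : BPoint →₀ ℤ) (Y : MCell) : MCell →₀ ℤ :=
  r.mapDomain fun x => Function.update Y f x

/-- the elementary null pieces of `◇_h⁴`: an R1∕R2 instance inside `◇_h` in one factor, a diamond cell elsewhere. -/
def diamondPieces (h : ℤ) : Set (MCell →₀ ℤ) :=
  {π | ∃ f : Fin 4, ∃ r : BPoint →₀ ℤ, ∃ Y : MCell, r ∈ diamondMoves h ∧ MCell.InDiamond h Y ∧ π = elemPiece f r Y}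

/-- the class function `w ↦ Σ_Z ν(Z)·ch(Z)(w)` of a signed integer design (`= MConfig.wch` for `ν = m_N − m_P`). -/
noncomputable def classOf (ν : MCell →₀ ℤ) : CWord → GaussianInt :=
  fun w => ν.sum fun Z m => (m : GaussianInt) * Z.ch w

/-- a design is NULL: its class function vanishes identically. -/
def CellNull (ν : MCell →₀ ℤ) : Prop := ∀ w : CWord, classOf ν w = 0

/-- support inside `◇_h⁴`. -/
def CellSupportedIn (h : ℤ) (ν : MCell →₀ ℤ) : Prop := ∀ Z ∈ ν.support, MCell.InDiamond h Z

/-- **THEOREM N (typed)**: a null design on `◇_h⁴` is a ℤ-combination of elementary null pieces of `◇_h⁴`. -/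
def DiamondCellNullGenerated (h : ℤ) : Prop :=
  ∀ ν : MCell →₀ ℤ, CellSupportedIn h ν → CellNull ν → ν ∈ Submodule.span ℤ (diamondPieces h)

/-- **THEOREM C, integral form (typed)**: two (A1)-clean designs on `◇_h⁴` with the same eleven invariants — the nine e-free reference
coefficients `λ_d = class(refWord d)` and `μ = class(eeee)`, `μ̄ = class(ēēēē)` — differ by elementary null pieces. (Over ℚ(i) the common
normal form is `Σ_d λ_d R_d + μ W + μ̄ W̄` on the 625 base cells, memo §3.) -/
def CleanRigidity (h : ℤ) : Prop :=
  ∀ ν ν' : MCell →₀ ℤ, CellSupportedIn h ν → CellSupportedIn h ν' →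
    ClassScreen (classOf ν) → ClassScreen (classOf ν') →
    (∀ d : Fin 9, classOf ν (refWord d) = classOf ν' (refWord d)) →
    classOf ν eWord = classOf ν' eWord → classOf ν ebarWord = classOf ν' ebarWord →
    ν - ν' ∈ Submodule.span ℤ (diamondPieces h)

/-! ## §3 Kernel probes (cheap sanity; the theorems themselves are NOT kernel-proved here) -/

/-- the five base letters lie in `◇_2` (hence in every `◇_h`, `h ≥ 2` even). [`decide`] -/
theorem baseLetter_inDiamond_two : ∀ j : Fin 5, InDiamond 2 (baseLetter j) := by decide

/-- the crossing null ray through `2I`: `(1,1,0) → (2,0,0) → (3,−1,0)` lies in `◇_4` (an R1 instance linking the apex `2I`). [`decide`] -/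
theorem crossing_ray_inDiamond_four :
    InDiamond 4 (1, 1, 0) ∧ InDiamond 4 (ray (1, 1, 0) 2 1) ∧ InDiamond 4 (ray (1, 1, 0) 2 2) ∧
      ray (1, 1, 0) 2 1 = (2, 0, 0) ∧ ray (1, 1, 0) 2 2 = (3, -1, 0) := by decide

end Summit.HodgeConjecture.HodgeConjecture.Cruxes.BlochSeedDiscOne.StrengthenCleanModule
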